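import Summits.QuantumFields.YangMills.Theorems.UnitScaleTiltProp7LaplaceAFlatLetters
import HarnessLib

/-!
# Route `UnitScaleTilt`, crux K1 «MinimiserStabilityRegPr» (stmt-QuantumFields-19200) — ARCHITECTURE (A′) «HCOW-VIA-Σ», THE (NORM) ROW OF THE KNIT DOOR ✓`Prop7HcoWOfSigmaRows[Slots]`:
# `c₀·Σ_b‖X b‖² ≤ ‖toL2 F K c₀ X‖² ≤ 2·c₀·Σ_b‖X b‖²` — the member's weighted `L²` norm against the chart mass in the `L²`-operator norm of `M₂(ℂ)`, background-free

Cell `ym3-torus` ∕ fleet seat `ym-ust-19200-p1` (gen 17, route-R E′ lead ∕ namer).  THEOREMS ONLY (0 `def`, 0 `sorry`); `--supports stmt-QuantumFields-19200`, count-neutral.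
YM₃ on T³ is a ladder rung (R3), not the Clay problem; nothing here claims the stub, the crux, `hcoW`, d = 4 or the mass gap.

WHY.  The doors ✓`hcoW_of_sigmaRowsW[_fam∕_slots]` display per competitor the row (NORM) `cN·Σ_b‖(ηA) b‖² ≤ ‖toL2 F K c₀ (ηA)‖²`; it is KINEMATIC: px6 g5's ✓`Prop7LaplaceAFlatLetters.norm_sq_toL2`
(`‖toL2 X‖² = c₀·Σ_b Σ_{jj′}|X(b)_{jj′}|²`, [B9] (3.11) with the Hilbert–Schmidt product) and lit ✓`MatrixNorms.opNorm_sq_le_sum_norm_sq` ∕ ✓`sum_norm_sq_le_two_mul_opNorm_sq`-class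
comparisons of the operator norm with the entry sum give it with `cN := c₀`, plus the reverse bound with `2·c₀` (so the door's constants are absolute in `c₀`).

WHAT IS PROVED (ns `…Theorems.Prop7SigmaRowsNorm`): ★★ `c0_mul_sum_norm_sq_le_norm_sq_toL2` (the (NORM) row, `cN := c₀`), ★ `norm_sq_toL2_le_two_mul` (the reverse bound).
HONEST SCOPE.  Norm bookkeeping; nothing of print asserted beyond the pairing's definition.

References: T. Bałaban, CMP 99 (1985) 389–434 [Balaban1985BackgroundPropagators] ((3.11) p.392); CMP 98 (1985) 17–51 [Balaban1985Averaging] ((18)–(20) p.21).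
-/

set_option autoImplicit false
noncomputable section

open scoped BigOperators Matrix.Norms.L2Operator Matrix InnerProductSpace

namespace Summit.QuantumFields.YangMills.Theorems.Prop7SigmaRowsNorm

open Literature.MathematicalPhysics.QuantumFieldTheory.Balaban1983to89
open Literature.MathematicalPhysics.QuantumFieldTheory.Balaban1983to89.T3ContinuumYM3Torus
open Summit.QuantumFields.YangMills.Theorems.Prop7SectET3HilbertLetters (toL2)
open Summit.QuantumFields.YangMills.Theorems.Prop7LaplaceAFlatLetters (norm_sq_toL2)

variable (F : T3Family) (K : ℕ) (c₀ : ℝ) [Fact (0 < c₀)]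

/-- ★★ **THE (NORM) ROW OF THE (A′) KNIT DOOR**: `c₀·Σ_b‖X b‖² ≤ ‖toL2 F K c₀ X‖²` (operator norm `≤` Hilbert–Schmidt norm, bondwise; [Balaban1985Averaging] (20)).
[cite: Balaban1985BackgroundPropagators, (3.11) p.392; Balaban1985Averaging, (20) p.21] -/
theorem c0_mul_sum_norm_sq_le_norm_sq_toL2 (X : PBond (F.P K) 0 → Matrix (Fin 2) (Fin 2) ℂ) :
    c₀ * ∑ b : PBond (F.P K) 0, ‖X b‖ ^ 2 ≤ ‖toL2 F K c₀ X‖ ^ 2 := by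
  rw [norm_sq_toL2]
  have hc : 0 ≤ c₀ := (Fact.out : 0 < c₀).le
  exact mul_le_mul_of_nonneg_left (Finset.sum_le_sum fun b _ => MatrixNorms.opNorm_sq_le_sum_norm_sq (X b)) hc

/-- ★ **THE REVERSE BOUND**: `‖toL2 F K c₀ X‖² ≤ 2·c₀·Σ_b‖X b‖²` (the entry sum of a `2×2` matrix is at most twice the squared operator norm: each column is bounded by the operator norm).
[cite: Balaban1985Averaging, (18)–(20) p.21] -/
theorem norm_sq_toL2_le_two_mul (X : PBond (F.P K) 0 → Matrix (Fin 2) (Fin 2) ℂ) :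
    ‖toL2 F K c₀ X‖ ^ 2 ≤ 2 * c₀ * ∑ b : PBond (F.P K) 0, ‖X b‖ ^ 2 := by
  rw [norm_sq_toL2]
  have hc : 0 ≤ c₀ := (Fact.out : 0 < c₀).le
  have hb : ∀ b : PBond (F.P K) 0, ∑ i, ∑ i', ‖X b i i'‖ ^ 2 ≤ 2 * ‖X b‖ ^ 2 := by
    intro b
    have h1 := MatrixNorms.card_mul_nhsNormSq (X b)
    have h2 := MatrixNorms.nhsNormSq_le_opNorm_sq (X b)
    simp only [Fintype.card_fin, Nat.cast_ofNat] at h1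
    rw [← h1]
    exact mul_le_mul_of_nonneg_left h2 (by norm_num)
  calc c₀ * ∑ b, ∑ i, ∑ i', ‖X b i i'‖ ^ 2 ≤ c₀ * ∑ b, 2 * ‖X b‖ ^ 2 :=
        mul_le_mul_of_nonneg_left (Finset.sum_le_sum fun b _ => hb b) hc
    _ = 2 * c₀ * ∑ b, ‖X b‖ ^ 2 := by rw [← Finset.mul_sum]; ring

end Summit.QuantumFields.YangMills.Theorems.Prop7SigmaRowsNorm

end
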